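import Mathlib
import HarnessLib
import Literature.Analysis.FluidPDE.RadialCalculus
import Literature.Analysis.PDE.LoewnerNirenbergKelvin
import Summits.NavierStokesRegularity.NavierStokesRegularity.Theorems.TypeIQuarterGateScarEnvelopeTypeIForcedTsaiHomogeneousTail

/-!
# ARM B — EXACT PART OF DATUM B-2j (ii): the dipole / Stokeslet vorticity tail `L y/|y|³` is an
  EXACT zero mode of the linearised Leray vorticity operator `A = −Δ + 1 + ½y·∇` on `ℝ³ ∖ {0}`
  (ns-wall-extremal, eng-1 lineage g4, 2026-08-29)

WHAT IS PROVED (theorem-only file; elementary calculus on explicit fields).  For every continuous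
linear `L : ℝ³ → ℝ³` put `W_L(y) := (‖y‖²)^{−3/2} • L y` (`= L y/|y|³`).
* `laplacian_dipoleTail` : `Δ W_L (x) = 0` for `x ≠ 0` — each component of `W_L` is a first
  partial derivative of the Newtonian potential `1/|y|`; proof by the tree's local Leibniz rule
  `LoewnerNirenberg.laplacian_smul_apply` and radial calculus `laplacian_comp_norm_sq`
  (`Δ = (4σg″ + 10g′)·L x = 0` for `g(σ) = σ^{−3/2}`, `σ = |x|²`).
* `dipoleTail_homogeneous` : `W_L(t•y) = (t²)⁻¹ • W_L(y)` for `t > 0` (degree `−2`).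
* ★ `linearisedVorticityOperator_dipoleTail` : `−ΔW_L(x) + W_L(x) + ½ DW_L(x)[x] = 0` for `x ≠ 0`,
  combining the two with `linearisedVorticityOperator_of_homogeneous_neg_two` (p688729).
* `divergence_dipoleTail_eq_zero` : for antisymmetric `L` the tail is divergence free off the origin
  (it is the vorticity of the Stokeslet velocity field).

MEANING FOR THE CELL (HOME/ARM-B/linfloor-eng1g4/LINEAR-FLOOR.md §1 (iv), §3; TABLE §E/§F).
With `L` antisymmetric (`L y = y × e`) `W_L` is the vorticity of the Stokeslet velocity field and is
exactly the exterior of the linear-floor mode (radial profile `f = c/r²`, `r·u → 1.3465`): it costs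
NOTHING in the registered residual, which is why the Type-I-tailed floor is `14.858` while every
fast-decaying class pays `27.767`.  (`L = id` gives `∇(−1/|y|)`, also a zero mode, not a vorticity.)

HONEST FRAME.  Pointwise identities for explicit fields on `ℝ³ ∖ {0}`; no statement about the wall
H3, crux `ScarEnvelopeTypeI` (stmt-23843, OPEN) or Navier–Stokes regularity (NOT proved).  No
definitions, no notation, standard axioms.
-/

noncomputable section

set_option linter.dupNamespace false

namespace Summit.NavierStokesRegularity.NavierStokesRegularity.Cruxes.ScarEnvelopeTypeI.ForcedTsai

open scoped Laplacian RealInnerProductSpace InnerProductSpace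
open Literature.Analysis.FluidPDE Literature.Analysis.PDE Set Filter

/-! ## The radial profile `g(σ) = σ^{-3/2}` -/

/-- `d/dσ σ^{-3/2} = -(3/2) σ^{-5/2}` on `σ > 0` (as `Real.hasDerivAt_rpow_const` states it). -/
theorem hasDerivAt_rpow_neg_three_halves {σ : ℝ} (hσ : 0 < σ) :
    HasDerivAt (fun s : ℝ => s ^ (-(3 : ℝ) / 2)) (-(3 : ℝ) / 2 * σ ^ (-(3 : ℝ) / 2 - 1)) σ := by
  simpa using Real.hasDerivAt_rpow_const (x := σ) (p := -(3 : ℝ) / 2) (Or.inl hσ.ne')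

/-- Second derivative of the profile. -/
theorem hasDerivAt_deriv_rpow_neg_three_halves {σ : ℝ} (hσ : 0 < σ) :
    HasDerivAt (fun s : ℝ => -(3 : ℝ) / 2 * s ^ (-(3 : ℝ) / 2 - 1))
      (-(3 : ℝ) / 2 * ((-(3 : ℝ) / 2 - 1) * σ ^ (-(3 : ℝ) / 2 - 1 - 1))) σ :=
  (Real.hasDerivAt_rpow_const (x := σ) (p := -(3 : ℝ) / 2 - 1) (Or.inl hσ.ne')).const_mul _

/-- The key cancellation `4σ g″(σ) + 10 g′(σ) = 0` for `g(σ) = σ^{-3/2}`, `σ > 0`. -/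
theorem four_mul_sq_deriv_add_ten_mul_deriv_eq_zero {σ : ℝ} (hσ : 0 < σ) :
    4 * (-(3 : ℝ) / 2 * ((-(3 : ℝ) / 2 - 1) * σ ^ (-(3 : ℝ) / 2 - 1 - 1))) * σ
      + 10 * (-(3 : ℝ) / 2 * σ ^ (-(3 : ℝ) / 2 - 1)) = 0 := by
  have e1 : σ ^ (-(3 : ℝ) / 2 - 1 - 1) * σ = σ ^ (-(3 : ℝ) / 2 - 1) := by
    rw [Real.rpow_sub_one hσ.ne' (-(3 : ℝ) / 2 - 1)]
    field_simp
  calc 4 * (-(3 : ℝ) / 2 * ((-(3 : ℝ) / 2 - 1) * σ ^ (-(3 : ℝ) / 2 - 1 - 1))) * σ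
        + 10 * (-(3 : ℝ) / 2 * σ ^ (-(3 : ℝ) / 2 - 1))
      = 15 * (σ ^ (-(3 : ℝ) / 2 - 1 - 1) * σ) - 15 * σ ^ (-(3 : ℝ) / 2 - 1) := by ring
    _ = 0 := by rw [e1]; ring

/-! ## The dipole tail `W_L(y) = (‖y‖²)^{-3/2} • L y` -/

/-- A continuous linear field is harmonic: `Δ(Ly) = 0`. -/
theorem laplacian_clm (L : E3 →L[ℝ] E3) (x : E3) : (Δ (fun y : E3 => L y)) x = 0 := by
  have h1 : fderiv ℝ (fun y : E3 => L y) = fun _ => L := by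
    funext y
    exact L.fderiv
  rw [InnerProductSpace.laplacian_eq_iteratedFDeriv_orthonormalBasis _
    (EuclideanSpace.basisFun (Fin 3) ℝ)]
  refine Finset.sum_eq_zero fun j _ => ?_
  rw [iteratedFDeriv_two_apply, h1, fderiv_fun_const]
  rfl

/-- The radial factor `y ↦ (‖y‖²)^{-3/2}` is `C²` away from the origin. -/
theorem contDiffAt_norm_sq_rpow_neg_three_halves {x : E3} (hx : x ≠ 0) :
    ContDiffAt ℝ 2 (fun y : E3 => (‖y‖ ^ 2) ^ (-(3 : ℝ) / 2)) x := by
  have hσ : (‖x‖ ^ 2) ≠ 0 := by positivity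
  exact ((contDiff_norm_sq ℝ (E := E3)).contDiffAt).rpow_const_of_ne hσ

/-- **The dipole tail is harmonic off the origin**: `Δ((‖y‖²)^{-3/2} • L y)(x) = 0` for `x ≠ 0`. -/
theorem laplacian_dipoleTail (L : E3 →L[ℝ] E3) {x : E3} (hx : x ≠ 0) :
    (Δ (fun y : E3 => (‖y‖ ^ 2) ^ (-(3 : ℝ) / 2) • L y)) x = 0 := by
  have hσ : 0 < ‖x‖ ^ 2 := by positivity
  set b := EuclideanSpace.basisFun (Fin 3) ℝ with hb
  have hφ := contDiffAt_norm_sq_rpow_neg_three_halves hx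
  have hL : ContDiffAt ℝ 2 (fun y : E3 => L y) x := L.contDiff.contDiffAt
  rw [LoewnerNirenberg.laplacian_smul_apply hφ hL b, laplacian_clm L x, smul_zero, add_zero]
  -- first derivatives: `∂ᵢ φ (x) = 2 g′(σ) ⟪x, bᵢ⟫`, `∂ᵢ (L y) = L bᵢ`
  have hg := hasDerivAt_rpow_neg_three_halves hσ
  have hd1 : ∀ i, fderiv ℝ (fun y : E3 => (‖y‖ ^ 2) ^ (-(3 : ℝ) / 2)) x (b i)
      = 2 * (-(3 : ℝ) / 2 * (‖x‖ ^ 2) ^ (-(3 : ℝ) / 2 - 1)) * ⟪x, b i⟫ := fun i =>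
    fderiv_comp_norm_sq_apply (g := fun s : ℝ => s ^ (-(3 : ℝ) / 2)) hg (b i)
  have hdL : ∀ i, fderiv ℝ (fun y : E3 => L y) x (b i) = L (b i) := fun i => by
    rw [show (fun y : E3 => L y) = ⇑L from rfl, L.fderiv]
  have hx_repr : ∑ i, ⟪x, b i⟫ • b i = x := by
    conv_rhs => rw [← b.sum_repr' x]
    exact Finset.sum_congr rfl fun i _ => by rw [real_inner_comm]
  have hLsum : ∑ i, ⟪x, b i⟫ • L (b i) = L x := by
    rw [← hx_repr, map_sum]
    simp_rw [map_smul, hx_repr]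
  have hsum : ∑ i, (fderiv ℝ (fun y : E3 => (‖y‖ ^ 2) ^ (-(3 : ℝ) / 2)) x (b i)) •
      fderiv ℝ (fun y : E3 => L y) x (b i)
      = (2 * (-(3 : ℝ) / 2 * (‖x‖ ^ 2) ^ (-(3 : ℝ) / 2 - 1))) • L x := by
    calc ∑ i, (fderiv ℝ (fun y : E3 => (‖y‖ ^ 2) ^ (-(3 : ℝ) / 2)) x (b i)) •
          fderiv ℝ (fun y : E3 => L y) x (b i)
        = ∑ i, (2 * (-(3 : ℝ) / 2 * (‖x‖ ^ 2) ^ (-(3 : ℝ) / 2 - 1)) * ⟪x, b i⟫) • L (b i) :=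
          Finset.sum_congr rfl fun i _ => by rw [hd1, hdL]
      _ = (2 * (-(3 : ℝ) / 2 * (‖x‖ ^ 2) ^ (-(3 : ℝ) / 2 - 1))) • ∑ i, ⟪x, b i⟫ • L (b i) := by
          rw [Finset.smul_sum]
          exact Finset.sum_congr rfl fun i _ => by rw [mul_smul]
      _ = (2 * (-(3 : ℝ) / 2 * (‖x‖ ^ 2) ^ (-(3 : ℝ) / 2 - 1))) • L x := by rw [hLsum]
  -- the Laplacian of the radial factor (`finrank = 3`)
  have hΔφ : (Δ (fun y : E3 => (‖y‖ ^ 2) ^ (-(3 : ℝ) / 2))) x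
      = 4 * (-(3 : ℝ) / 2 * ((-(3 : ℝ) / 2 - 1) * (‖x‖ ^ 2) ^ (-(3 : ℝ) / 2 - 1 - 1))) * ‖x‖ ^ 2
        + 2 * (3 : ℕ) * (-(3 : ℝ) / 2 * (‖x‖ ^ 2) ^ (-(3 : ℝ) / 2 - 1)) := by
    have key := laplacian_comp_norm_sq (E := E3) (g := fun s : ℝ => s ^ (-(3 : ℝ) / 2))
      (g₁ := fun s : ℝ => -(3 : ℝ) / 2 * s ^ (-(3 : ℝ) / 2 - 1)) isOpen_Ioi
      (fun s hs => hasDerivAt_rpow_neg_three_halves hs) (z := x) hσ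
      (hasDerivAt_deriv_rpow_neg_three_halves hσ)
    rw [key, finrank_euclideanSpace_fin]
  rw [hsum, hΔφ, smul_smul, ← add_smul]
  have h0 : 4 * (-(3 : ℝ) / 2 * ((-(3 : ℝ) / 2 - 1) * (‖x‖ ^ 2) ^ (-(3 : ℝ) / 2 - 1 - 1))) * ‖x‖ ^ 2
        + 2 * (3 : ℕ) * (-(3 : ℝ) / 2 * (‖x‖ ^ 2) ^ (-(3 : ℝ) / 2 - 1))
        + 2 * (2 * (-(3 : ℝ) / 2 * (‖x‖ ^ 2) ^ (-(3 : ℝ) / 2 - 1))) = 0 := by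
    have := four_mul_sq_deriv_add_ten_mul_deriv_eq_zero hσ
    push_cast
    linarith
  rw [h0, zero_smul]

/-- **Degree `−2` homogeneity of the dipole tail**: `W_L(t•y) = (t²)⁻¹ • W_L(y)` for `t > 0`. -/
theorem dipoleTail_homogeneous (L : E3 →L[ℝ] E3) (y : E3) {t : ℝ} (ht : 0 < t) :
    (‖t • y‖ ^ 2) ^ (-(3 : ℝ) / 2) • L (t • y) = (t ^ 2)⁻¹ • ((‖y‖ ^ 2) ^ (-(3 : ℝ) / 2) • L y) := by
  have hn : ‖t • y‖ ^ 2 = t ^ 2 * ‖y‖ ^ 2 := by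
    rw [norm_smul, Real.norm_eq_abs, abs_of_pos ht]; ring
  have h1 : (t ^ 2 * ‖y‖ ^ 2) ^ (-(3 : ℝ) / 2) = t ^ (-(3 : ℝ)) * (‖y‖ ^ 2) ^ (-(3 : ℝ) / 2) := by
    rw [Real.mul_rpow (by positivity) (by positivity)]
    congr 1
    rw [show (t ^ 2 : ℝ) = t ^ (2 : ℝ) by norm_cast, ← Real.rpow_mul ht.le]
    norm_num
  have h2 : t ^ (-(3 : ℝ)) * t = (t ^ 2)⁻¹ := by
    rw [show (t ^ 2)⁻¹ = t ^ (-(2 : ℝ)) by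
      rw [Real.rpow_neg ht.le, show (t ^ (2 : ℝ)) = t ^ 2 by norm_cast]]
    conv_lhs => rw [show (t : ℝ) = t ^ (1 : ℝ) by simp, ← Real.rpow_mul ht.le,
      ← Real.rpow_add ht]
    norm_num
  rw [hn, map_smul, h1, smul_smul, mul_assoc, mul_comm ((‖y‖ ^ 2) ^ (-(3 : ℝ) / 2)) t,
    ← mul_assoc, h2, ← smul_smul]

/-- The dipole tail is differentiable off the origin. -/
theorem differentiableAt_dipoleTail (L : E3 →L[ℝ] E3) {x : E3} (hx : x ≠ 0) :
    DifferentiableAt ℝ (fun y : E3 => (‖y‖ ^ 2) ^ (-(3 : ℝ) / 2) • L y) x :=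
  ((contDiffAt_norm_sq_rpow_neg_three_halves hx).differentiableAt (by norm_num)).smul
    (L.differentiableAt)

/-- ★ **The dipole / Stokeslet vorticity tail is an exact zero mode of the linearised Leray
vorticity operator**: for every continuous linear `L : ℝ³ → ℝ³` and `x ≠ 0`,
`−ΔW_L(x) + W_L(x) + ½ DW_L(x)[x] = 0` with `W_L(y) = (‖y‖²)^{-3/2} • L y`.  (Antisymmetric `L`:
the exterior of the linear-floor mode of DATUM B-2j, free in the registered currency.) -/
theorem linearisedVorticityOperator_dipoleTail (L : E3 →L[ℝ] E3) {x : E3} (hx : x ≠ 0) :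
    -((Δ (fun y : E3 => (‖y‖ ^ 2) ^ (-(3 : ℝ) / 2) • L y)) x)
      + (‖x‖ ^ 2) ^ (-(3 : ℝ) / 2) • L x
      + (1 / 2 : ℝ) • fderiv ℝ (fun y : E3 => (‖y‖ ^ 2) ^ (-(3 : ℝ) / 2) • L y) x x = 0 := by
  have hhom : ∀ t : ℝ, 0 < t → (fun y : E3 => (‖y‖ ^ 2) ^ (-(3 : ℝ) / 2) • L y) (t • x)
      = (t ^ 2)⁻¹ • (fun y : E3 => (‖y‖ ^ 2) ^ (-(3 : ℝ) / 2) • L y) x :=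
    fun t ht => dipoleTail_homogeneous L x ht
  have h := linearisedVorticityOperator_of_homogeneous_neg_two hhom (differentiableAt_dipoleTail L hx)
  rw [h, laplacian_dipoleTail L hx, neg_zero]

/-! ## Antisymmetric `L`: the dipole tail is divergence free (a genuine vorticity field) -/

/-- **For antisymmetric `L` (`⟪Lv, w⟫ = −⟪v, Lw⟫`, i.e. `L y = y × e`) the dipole tail is
DIVERGENCE FREE off the origin** — it is the vorticity of the Stokeslet velocity field, the exterior
of the linear-floor mode: `div((‖y‖²)^{-3/2} • L y)(x) = (‖x‖²)^{-3/2} tr L + 2g′(|x|²)⟪x, Lx⟫ = 0`. -/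
theorem divergence_dipoleTail_eq_zero (L : E3 →L[ℝ] E3) (hL : ∀ v w : E3, ⟪L v, w⟫ = -⟪v, L w⟫)
    {x : E3} (hx : x ≠ 0) :
    VectorCalculus.divergence (fun y : E3 => (‖y‖ ^ 2) ^ (-(3 : ℝ) / 2) • L y) x = 0 := by
  have hσ : 0 < ‖x‖ ^ 2 := by positivity
  set b := EuclideanSpace.basisFun (Fin 3) ℝ with hb
  have hg := hasDerivAt_rpow_neg_three_halves hσ
  have hφ := hasFDerivAt_comp_norm_sq (E := E3) (g := fun s : ℝ => s ^ (-(3 : ℝ) / 2)) hg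
  have hW : HasFDerivAt (fun y : E3 => (‖y‖ ^ 2) ^ (-(3 : ℝ) / 2) • L y)
      ((‖x‖ ^ 2) ^ (-(3 : ℝ) / 2) • (L : E3 →L[ℝ] E3) +
        ((2 * (-(3 : ℝ) / 2 * (‖x‖ ^ 2) ^ (-(3 : ℝ) / 2 - 1))) • (innerSL ℝ x : E3 →L[ℝ] ℝ)).smulRight
          (L x)) x :=
    hφ.smul L.hasFDerivAt
  have anti_self : ∀ v : E3, ⟪v, L v⟫ = 0 := fun v => by
    have h := hL v v
    rw [real_inner_comm] at h
    linarith
  rw [divergence_eq_sum_inner_fderiv b, hW.fderiv]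
  have hterm : ∀ i, ⟪b i, ((‖x‖ ^ 2) ^ (-(3 : ℝ) / 2) • (L : E3 →L[ℝ] E3) +
      ((2 * (-(3 : ℝ) / 2 * (‖x‖ ^ 2) ^ (-(3 : ℝ) / 2 - 1))) • (innerSL ℝ x : E3 →L[ℝ] ℝ)).smulRight
        (L x)) (b i)⟫
      = (2 * (-(3 : ℝ) / 2 * (‖x‖ ^ 2) ^ (-(3 : ℝ) / 2 - 1))) * (⟪x, b i⟫ * ⟪b i, L x⟫) := by
    intro i
    simp only [add_apply, FunLike.coe_smul, Pi.smul_apply,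
      ContinuousLinearMap.smulRight_apply, innerSL_real_coe_apply_apply, inner_add_right,
      real_inner_smul_right, anti_self, mul_zero, zero_add, smul_eq_mul]
    ring
  simp_rw [hterm, ← Finset.mul_sum, b.sum_inner_mul_inner, anti_self, mul_zero]

end Summit.NavierStokesRegularity.NavierStokesRegularity.Cruxes.ScarEnvelopeTypeI.ForcedTsai

end
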